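import Mathlib
import Literature.NumberTheory.EllipticCurves.ThreeIsogeny
import Literature.NumberTheory.EllipticCurves.MordellCurvePhiDescentHom
import Summits.BirchSwinnertonDyer.BirchSwinnertonDyer.Theorems.Rank2ObservatoryThreeIsoDescentEhat

/-!
# Rank-2 observatory — KERNEL-3ISO B3a: the field `K = ℚ(ζ₃)` and `θ = 2ζ + 1 = √-3`

HONEST FRAMING: per-curve certified theorems and census instruments; no claim on BSD in rank ≥ 2.

The `Ê`-side 3-descent map (`exists_descentHom_Ehat`, B1) is stated over any field `K ∋ θ` with
`θ² = -3` and the Kummer containment needs `K = ℚ(θ)` (hypothesis `hK : ∀ γ, ∃ u v : ℚ,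
γ = u + vθ`). This def-free file discharges both for a third cyclotomic field, in the generality
`[IsCyclotomicExtension {3} ℚ K]` with `ζ` any primitive cube root of unity (so that per-row files
may take `K := CyclotomicField 3 ℚ`, `ζ := IsCyclotomicExtension.zeta 3 ℚ K` and import Mathlib's
arithmetic of `𝓞 K = ℤ[ζ]` — `IsCyclotomicExtension.Rat.three_pid`, `…Rat.Three.Units.mem` — for
the support law B3b):

* `zeta_sq_add_zeta_add_one` — `ζ² + ζ + 1 = 0`; `theta_sq_eq` — `(2ζ + 1)² = -3`;
* `exists_rat_coords_zeta` — every `γ ∈ K` is `a + bζ` (`K = ℚ(ζ)`, division by `X² + X + 1`);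
  `exists_rat_coords_theta` — every `γ ∈ K` is `u + v(2ζ + 1)`, `u, v ∈ ℚ`;
* the `CyclotomicField 3 ℚ` specialisations `theta_sq_cyclotomicField`, `exists_rat_coords_cyclotomicField`;
* `exists_descentHom_Ehat_cyclotomic` — B1 packaged: for a rational Vélu pair `h` and a third
  cyclotomic field `K ∋ ζ`, THE `Ê`-side descent map `κ' : Ê(ℚ) →+ Additive (K*/K*³)` with its
  values `[Y - θ(m x̂ + b̂)]`, `θ = 2ζ + 1`, AND `ker κ' ≤ φ(E(ℚ))` — the `(κ', hκ')` input of
  `three_pow_mordellWeilRank_succ_le_of_zsmul` in per-row certificates;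
* pure algebra of the support law (any commutative ring): `not_dvd_both_of_good` — a prime dividing
  `B - θC` and `B + θC` divides `2θs₁` (given `B² + 3C² = A³`, `C = m₁AE + s₁E³`, `gcd(A,E) = 1`);
  `pow_dvd_sub_of_not_dvd_add` — off such primes `πⁿ ∣ A³ ⇒ πⁿ ∣ B - θC`.

References: [Cohen2007NumberTheoryI] §8.4.2 (`K_d̂ = ℚ(√-3)` for `d = 1`); [CohenPazuki2009] §2.
-/

set_option linter.dupNamespace false

noncomputable section

open scoped Classical

open Polynomial WeierstrassCurve

namespace Summit.BirchSwinnertonDyer.BirchSwinnertonDyer.Rank2Observatory.ThreeIso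

open Literature.NumberTheory.EllipticCurves Literature.NumberTheory.EllipticCurves.MordellDescent

variable {K : Type*} [Field K]

/-- `ζ² + ζ + 1 = 0` for a primitive cube root of unity in a field. [folklore] -/
theorem zeta_sq_add_zeta_add_one {ζ : K} (hζ : IsPrimitiveRoot ζ 3) : ζ ^ 2 + ζ + 1 = 0 := by
  have h3 : ζ ^ 3 = 1 := hζ.pow_eq_one
  have h1 : ζ ≠ 1 := hζ.ne_one (by norm_num)
  have hfac : (ζ - 1) * (ζ ^ 2 + ζ + 1) = 0 := by linear_combination h3
  rcases mul_eq_zero.mp hfac with h | h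
  · exact absurd (sub_eq_zero.mp h) h1
  · exact h

/-- `θ = 2ζ + 1` satisfies `θ² = -3`. [folklore] -/
theorem theta_sq_eq {ζ : K} (hζ : IsPrimitiveRoot ζ 3) : (2 * ζ + 1) ^ 2 = -3 := by
  linear_combination (4 : K) * zeta_sq_add_zeta_add_one hζ

variable [CharZero K] [IsCyclotomicExtension {3} ℚ K]

/-- **`K = ℚ(ζ)` has `ℚ`-basis `1, ζ`:** every `γ ∈ K` is `a + bζ` with `a, b ∈ ℚ` (`γ` is a
polynomial in `ζ`; divide by the monic `X² + X + 1`). [folklore] -/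
theorem exists_rat_coords_zeta {ζ : K} (hζ : IsPrimitiveRoot ζ 3) (γ : K) :
    ∃ a b : ℚ, γ = a + b * ζ := by
  have hmem : γ ∈ Algebra.adjoin ℚ ({ζ} : Set K) := by
    rw [IsCyclotomicExtension.adjoin_primitive_root_eq_top (n := 3) (A := ℚ) hζ]
    exact Algebra.mem_top
  rw [Algebra.adjoin_singleton_eq_range_aeval, AlgHom.mem_range] at hmem
  obtain ⟨p, rfl⟩ := hmem
  set q : ℚ[X] := X ^ 2 + X + 1 with hq
  have hqm : q.Monic := by
    rw [hq]
    -- `X² + X + 1` is monic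
    have : (X ^ 2 + X + 1 : ℚ[X]) = X ^ 2 + (X + 1) := by ring
    rw [this]
    exact monic_X_pow_add (by
      calc (X + 1 : ℚ[X]).degree ≤ 1 := by compute_degree
        _ < 2 := by norm_num)
  have hdiv := modByMonic_add_div p q
  have hζq : aeval ζ q = 0 := by
    rw [hq]
    simp only [map_add, map_pow, aeval_X, map_one]
    exact zeta_sq_add_zeta_add_one hζ
  have hdeg : (p %ₘ q).degree ≤ 1 := by
    have hlt : (p %ₘ q).degree < q.degree := degree_modByMonic_lt p hqm
    have hqd : q.degree = 2 := by
      rw [hq]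
      compute_degree!
    rw [hqd] at hlt
    exact Order.le_of_lt_succ hlt
  have hr := eq_X_add_C_of_degree_le_one hdeg
  refine ⟨(p %ₘ q).coeff 0, (p %ₘ q).coeff 1, ?_⟩
  conv_lhs => rw [← hdiv, map_add, map_mul, hζq, zero_mul, add_zero, hr]
  simp only [map_add, map_mul, aeval_C, aeval_X, eq_ratCast]
  ring

/-- Every `γ ∈ K = ℚ(ζ₃)` is `u + vθ` with `θ = 2ζ + 1`, `u, v ∈ ℚ` — the hypothesis `hK` of
`ker_descentHom_Ehat_le_range`. [folklore] -/
theorem exists_rat_coords_theta {ζ : K} (hζ : IsPrimitiveRoot ζ 3) (γ : K) :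
    ∃ u v : ℚ, γ = u + v * (2 * ζ + 1) := by
  obtain ⟨a, b, rfl⟩ := exists_rat_coords_zeta hζ γ
  refine ⟨a - b / 2, b / 2, ?_⟩
  push_cast
  ring

/-! ### B1 packaged for a third cyclotomic field -/

/-- **The `Ê`-side descent map over `K = ℚ(ζ₃)` with its Kummer containment.** For a rational
Vélu three-pair `h` (`φ : E → Ê`): an additive `κ' : Ê(ℚ) →+ K*/K*³` with
`κ'(X, Y) = [Y - θ(m(X + 4m²/3) + (27s - 4m³)/9)]`, `θ = 2ζ + 1`, at every affine rational point,
and `ker κ' ≤ φ(E(ℚ))`. [cite: Cohen2007NumberTheoryI, Def. 8.4.7, Prop. 8.4.8 (1)–(2)] -/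
theorem exists_descentHom_Ehat_cyclotomic {ζ : K} (hζ : IsPrimitiveRoot ζ 3) {m s : ℚ}
    {W W' : WeierstrassCurve ℚ} (h : IsVeluThreePair m s W W') :
    ∃ κ' : W'.toAffine.Point →+ Additive (CubeUnits K),
      (∀ (X Y : ℚ) (hQ : W'.toAffine.Nonsingular X Y),
        κ' (.some X Y hQ) = Additive.ofMul (cubeClass
          ((Y : K) - (2 * ζ + 1) * ((m : K) * ((X : K) + 4 * (m : K) ^ 2 / 3)
            + (27 * (s : K) - 4 * (m : K) ^ 3) / 9)))) ∧
      κ'.ker ≤ h.pointHom.range := by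
  obtain ⟨κ', hκ'⟩ := exists_descentHom_Ehat h (theta_sq_eq hζ)
  exact ⟨κ', hκ', ker_descentHom_Ehat_le_range h (theta_sq_eq hζ) (exists_rat_coords_theta hζ) κ' hκ'⟩

/-! ### The specialisation `K = CyclotomicField 3 ℚ`, `ζ = zeta 3 ℚ K` -/

set_option backward.isDefEq.respectTransparency false in
/-- `θ² = -3` in `CyclotomicField 3 ℚ` for `θ = 2·zeta + 1` (the instance
`IsCyclotomicExtension {3} ℚ (CyclotomicField 3 ℚ)` unifies with Mathlib's `ℚ`-algebra structure
only without transparency restrictions, as in Mathlib's `fermatLastTheoremThree`). [folklore] -/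
theorem theta_sq_cyclotomicField :
    (2 * IsCyclotomicExtension.zeta 3 ℚ (CyclotomicField 3 ℚ) + 1) ^ 2 = -3 :=
  theta_sq_eq (IsCyclotomicExtension.zeta_spec 3 ℚ (CyclotomicField 3 ℚ))

set_option backward.isDefEq.respectTransparency false in
/-- Every element of `CyclotomicField 3 ℚ` is `u + vθ`, `u, v ∈ ℚ`. [folklore] -/
theorem exists_rat_coords_cyclotomicField (γ : CyclotomicField 3 ℚ) :
    ∃ u v : ℚ, γ = u + v * (2 * IsCyclotomicExtension.zeta 3 ℚ (CyclotomicField 3 ℚ) + 1) :=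
  exists_rat_coords_theta (IsCyclotomicExtension.zeta_spec 3 ℚ (CyclotomicField 3 ℚ)) γ

/-! ### Pure algebra of the `Ê`-side support law: common prime divisors are bad

Integral form of an affine rational point of `Ê` (B1 `descent_Ehat_rescale`): `X₂ = A/E²`,
`Y₂ = B/E³`, `gcd(A, E) = 1`, `δ_int = B - θC`, `C = m₁AE + s₁E³`, and the norm condition
`B² + 3C² = A³`. In any commutative ring: a prime dividing both `δ_int` and its conjugate
`B + θC` divides `2θs₁`. Hence, off the primes of `2θs₁`, at most one of `δ_int`, `δ̄_int` is
divisible by a given prime, and (in the UFD `ℤ[ζ₃]`) `v_π(δ_int) = v_π(A³) ≡ 0 (mod 3)` — the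
support law proper is assembled from this in the B3b file. -/

section SupportAlgebra

variable {R : Type*} [CommRing R]

/-- **Common prime divisors of `B - θC` and `B + θC` divide `2θs₁`** (given `B² + 3C² = A³`,
`C = m₁AE + s₁E³`, `gcd(A, E) = 1`). [cite: CohenPazuki2009, Thm. 2.3 (proof pattern); Cohen2007NumberTheoryI, Prop. 8.4.8 (3)] -/
theorem not_dvd_both_of_good {θ π A B C E m₁ s₁ : R} (hπ : Prime π)
    (hN : B ^ 2 + 3 * C ^ 2 = A ^ 3) (hC : C = m₁ * A * E + s₁ * E ^ 3) (hAE : IsCoprime A E)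
    (hgood : ¬ π ∣ 2 * θ * s₁) (h₁ : π ∣ B - θ * C) (h₂ : π ∣ B + θ * C) : False := by
  have h2θ : ¬ π ∣ 2 * θ := fun h => hgood (dvd_mul_of_dvd_left h s₁)
  have h2 : ¬ π ∣ 2 := fun h => h2θ (dvd_mul_of_dvd_left h θ)
  -- `π ∣ 2θC` and `π ∣ 2B`
  have hC' : π ∣ C := by
    have : π ∣ 2 * θ * C := by
      have h := dvd_sub h₂ h₁
      rw [show B + θ * C - (B - θ * C) = 2 * θ * C by ring] at h
      exact h
    rcases hπ.dvd_or_dvd this with h | h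
    · exact absurd h h2θ
    · exact h
  have hB : π ∣ B := by
    have : π ∣ 2 * B := by
      have h := dvd_add h₁ h₂
      rw [show B - θ * C + (B + θ * C) = 2 * B by ring] at h
      exact h
    rcases hπ.dvd_or_dvd this with h | h
    · exact absurd h h2
    · exact h
  -- `π ∣ A³`, so `π ∣ A`
  have hA : π ∣ A := by
    apply hπ.dvd_of_dvd_pow (n := 3)
    rw [← hN]
    exact dvd_add (dvd_pow hB two_ne_zero) (dvd_mul_of_dvd_right (dvd_pow hC' two_ne_zero) 3)
  -- `π ∣ s₁E³`, so `π ∣ E`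
  have hE : π ∣ E := by
    have : π ∣ s₁ * E ^ 3 := by
      have h := dvd_sub hC' (dvd_mul_of_dvd_left (dvd_mul_of_dvd_right hA m₁) E)
      rw [hC, show m₁ * A * E + s₁ * E ^ 3 - m₁ * A * E = s₁ * E ^ 3 by ring] at h
      exact h
    rcases hπ.dvd_or_dvd this with h | h
    · exact absurd (dvd_mul_of_dvd_right h (2 * θ)) hgood
    · exact hπ.dvd_of_dvd_pow h
  -- contradiction with `gcd(A, E) = 1`
  obtain ⟨u, v, huv⟩ := hAE
  have h1 : π ∣ (1 : R) := by
    rw [← huv]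
    exact dvd_add (dvd_mul_of_dvd_right hA u) (dvd_mul_of_dvd_right hE v)
  exact hπ.not_unit (isUnit_of_dvd_one h1)

/-- The product `(B - θC)(B + θC) = B² + 3C²` (`θ² = -3`). [folklore] -/
theorem sub_mul_add_theta {θ : R} (hθ : θ ^ 2 = -3) (B C : R) :
    (B - θ * C) * (B + θ * C) = B ^ 2 + 3 * C ^ 2 := by
  linear_combination (-C ^ 2) * hθ

/-- **Off the bad primes exactly one side carries the prime:** for a prime `π ∤ 2θs₁` dividing
`A`, either `π ∤ B - θC` (and then `π³ᵏ ∣ B + θC` to the full power of `A³`) or `π ∤ B + θC`.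
Stated as: `π ∣ B - θC → ¬ π ∣ B + θC`. [cite: CohenPazuki2009, §2] -/
theorem not_dvd_conj_of_dvd {θ π A B C E m₁ s₁ : R} (hπ : Prime π)
    (hN : B ^ 2 + 3 * C ^ 2 = A ^ 3) (hC : C = m₁ * A * E + s₁ * E ^ 3) (hAE : IsCoprime A E)
    (hgood : ¬ π ∣ 2 * θ * s₁) (h₁ : π ∣ B - θ * C) : ¬ π ∣ B + θ * C :=
  fun h₂ => not_dvd_both_of_good hπ hN hC hAE hgood h₁ h₂

/-- **Valuation law off the bad primes (power form).** In a commutative ring, if `π ∤ 2θs₁` is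
prime and `π ∤ B + θC`, then every power `πⁿ ∣ A³` already divides `B - θC`: with
`(B - θC)(B + θC) = A³`, `πⁿ ∣ (B - θC)(B + θC)` and `π` coprime to the second factor.
(In the UFD `ℤ[ζ₃]` this gives `v_π(B - θC) = 3 v_π(A)`.) [cite: CohenPazuki2009, §2] -/
theorem pow_dvd_sub_of_not_dvd_add [IsDomain R] {θ π A B C : R} (hπ : Prime π) (hθ : θ ^ 2 = -3)
    (hN : B ^ 2 + 3 * C ^ 2 = A ^ 3) (h₂ : ¬ π ∣ B + θ * C) {n : ℕ} (hn : π ^ n ∣ A ^ 3) :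
    π ^ n ∣ B - θ * C := by
  have hprod : π ^ n ∣ (B - θ * C) * (B + θ * C) := by
    rw [sub_mul_add_theta hθ, hN]
    exact hn
  exact hπ.pow_dvd_of_dvd_mul_right n h₂ hprod

end SupportAlgebra

end Summit.BirchSwinnertonDyer.BirchSwinnertonDyer.Rank2Observatory.ThreeIso
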